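import Mathlib.Analysis.Calculus.ContDiff.Operations
import Mathlib.Analysis.Calculus.FDeriv.Pi
import Mathlib.Analysis.Calculus.FDeriv.Prod
import Mathlib.Analysis.Calculus.Deriv.Prod
import Mathlib.Analysis.Calculus.Deriv.Pi
import Mathlib.Analysis.Calculus.Deriv.Comp
import Mathlib.Analysis.Normed.Operator.Prod
import Literature.Analysis.Calculus.JointSmoothnessPartials
import HarnessLib

/-!
# Joint smoothness of solutions of evolution equations from smooth slices: the jet calculus

Analysis/Calculus support file (everything proved, no named facts). It supplies the step
"using the system on `u_ε`, we finally get a control of the `C^s` norm in all variables"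
(S. Alinhac, *Hyperbolic Partial Differential Equations* (2009), proof of Thm. 7.11, Step 2 (d),
p. 94) in the form needed when a solution of an evolution equation

  `∂ₜ b(t, x) = N(t, x, b(t, x), D_x b(t, x), …, D_x^{m₀} b(t, x))`

has been constructed **slice-wise**: one knows that every time slice `b(t, ·)` is `C^∞` in `x`,
that all spatial derivatives `(t, x) ↦ D_x^k b(t, ·)(x)` are jointly continuous, and that they are
differentiable in time with `∂ₜ D_x^k b = D_x^k (N(t, ·, jet b(t, ·)))` pointwise (this is what a
limit of regularised solutions, uniform in all spatial derivatives, delivers). **Conclusion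
(`contDiff_uncurry_of_jet_evolution`): `b` is `C^∞` jointly in `(t, x)`.**

The proof is the classical bootstrap "time derivatives through the equation", organised so that
no symmetry of mixed partials is ever needed: let `𝒲_m` be the class of *smooth jet expressions
of order `m`*, `F(t, x) = Φ(t, x, j^m_x b(t, ·))` (`IsJetExprOf b m F`; `Φ` smooth on
`ℝ × X × Jet m`, `Jet m` the finite product of the spaces of `k`-multilinear maps, `k ≤ m`,
`jet m f x = (D^k f(x))_{k ≤ m}`). Then (i) every `F ∈ 𝒲_m` is continuous; (ii) `𝒲` is closed
under `∂ₓ` with a shift of order — the chain rule and `D_x(jet m f) = shift (jet (m+1) f)`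
(`hasFDerivAt_jet`, Mathlib's `fderiv_iteratedFDeriv` read through the currying isometry);
(iii) `𝒲` is closed under `∂ₜ` — the chain rule, the hypothesis `∂ₜ jet b = jet (N ∘ jet b)`, and
the fact that `jet m (N(t, ·, jet b))` is again a jet expression, of order `m₀ + m`
(`isJetExprOf_jet_rhs`, the `m`-fold *prolongation* of `N`, by (ii) and induction);
(iv) hence, by induction on `n` simultaneously for all members of all `𝒲_m` (with values in any
normed space), every jet expression is `C^n`, the step `n → n + 1` being the criterion "`C^n`
partial derivatives ⇒ `C^{n+1}`" of the tree (`Literature.Analysis.Calculus.contDiffOn_succ_of_partial`,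
Dieudonné (8.9.1)); and `b ∈ 𝒲_0`.

## Mathlib / tree search

Mathlib (this pin): `iteratedFDeriv`, `fderiv_iteratedFDeriv`, the currying isometries
`continuousMultilinearCurryLeftEquiv`, `continuousMultilinearCurryFin0`, `hasFDerivAt_pi'`,
`hasDerivAt_pi`, `contDiff_infty`; no jet spaces / prolongation (`lean search 'jet|prolong'`:
only unrelated uses). Tree: `Calculus/JointSmoothnessPartials` (`contDiffOn_succ_of_partial`;
its `contDiffOn_uncurry_of_mixed_partials` needs *all* time derivatives as data, which the
slice-wise construction does not provide — this file derives them from the equation instead).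

## References

* S. Alinhac, *Hyperbolic Partial Differential Equations*, Springer (2009), proof of Thm. 7.11,
  Step 2 (d). [`AlinhacHPDE2009`]
* J. Dieudonné, *Foundations of Modern Analysis* (1960), (8.9.1) and (8.12) (higher derivatives
  as multilinear maps, currying). [folklore]
-/

noncomputable section

open Set Function Filter
open scoped Topology ContDiff

namespace Literature.Analysis.Calculus

universe u

variable {X : Type u} [NormedAddCommGroup X] [NormedSpace ℝ X]
variable {W : Type u} [NormedAddCommGroup W] [NormedSpace ℝ W]

/-! ### Jet spaces -/

variable (X W) in
/-- The space of **`m`-jets** of maps `X → W` at a point: the finite product, over `k ≤ m`, of the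
spaces of continuous `k`-multilinear maps `X^k → W` (the values of `D^k f(x)`); a normed space.
[folklore] -/
abbrev Jet (m : ℕ) : Type u :=
  (k : Fin (m + 1)) → ContinuousMultilinearMap ℝ (fun _ : Fin k => X) W

/-- The **`m`-jet** of `f` at `x`: `jet m f x = (D^k f (x))_{k ≤ m}` (Mathlib's `iteratedFDeriv`).
[folklore] -/
def jet (m : ℕ) (f : X → W) (x : X) : Jet X W m := fun k => iteratedFDeriv ℝ k f x

/-- Components of the jet. [folklore] -/
@[simp]
theorem jet_apply (m : ℕ) (f : X → W) (x : X) (k : Fin (m + 1)) :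
    jet m f x k = iteratedFDeriv ℝ k f x := rfl

/-- **Truncation** of jets `Jet m' → Jet m`, `m ≤ m'` (forget the orders `> m`), a continuous
linear map. [folklore] -/
def Jet.truncLE {m m' : ℕ} (h : m ≤ m') : Jet X W m' →L[ℝ] Jet X W m :=
  ContinuousLinearMap.pi fun k =>
    (ContinuousLinearMap.proj (Fin.castLE (Nat.succ_le_succ h) k) :
      Jet X W m' →L[ℝ] ContinuousMultilinearMap ℝ (fun _ : Fin k => X) W)

/-- Components of the truncation. [folklore] -/
@[simp]
theorem Jet.truncLE_apply {m m' : ℕ} (h : m ≤ m') (j : Jet X W m') (k : Fin (m + 1)) :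
    Jet.truncLE h j k = j (Fin.castLE (Nat.succ_le_succ h) k) := rfl

/-- Truncating a jet of `f` gives the lower-order jet of `f`. [folklore] -/
@[simp]
theorem Jet.truncLE_jet {m m' : ℕ} (h : m ≤ m') (f : X → W) (x : X) :
    Jet.truncLE h (jet m' f x) = jet m f x := rfl

/-- The **shift** (formal derivative) of a jet: from `(A_k)_{k ≤ m+1}` to the linear map
`v ↦ (A_{k+1}(v, ·))_{k ≤ m}`, currying the first variable of each component of positive order
(a continuous linear map in `v`; linear and bounded in the jet, `Jet.isBoundedLinearMap_shiftFun`).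
[folklore] -/
def Jet.shiftFun {m : ℕ} (j : Jet X W (m + 1)) : X →L[ℝ] Jet X W m :=
  ContinuousLinearMap.pi fun k : Fin (m + 1) =>
    (continuousMultilinearCurryLeftEquiv ℝ (fun _ : Fin ((k : ℕ) + 1) => X) W (j k.succ) :
      X →L[ℝ] ContinuousMultilinearMap ℝ (fun _ : Fin k => X) W)

/-- Components of the shift: `(shift j v)_k = A_{k+1}(v, ·)`. [folklore] -/
@[simp]
theorem Jet.shiftFun_apply_apply {m : ℕ} (j : Jet X W (m + 1)) (v : X) (k : Fin (m + 1))
    (w : Fin k → X) : Jet.shiftFun j v k w = j k.succ (Fin.cons v w) := rfl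

/-- The shift is additive in the jet. [folklore] -/
theorem Jet.shiftFun_add {m : ℕ} (j j' : Jet X W (m + 1)) :
    Jet.shiftFun (j + j') = Jet.shiftFun j + Jet.shiftFun j' := by
  ext v k w
  rfl

/-- The shift is homogeneous in the jet. [folklore] -/
theorem Jet.shiftFun_smul {m : ℕ} (c : ℝ) (j : Jet X W (m + 1)) :
    Jet.shiftFun (c • j) = c • Jet.shiftFun j := by
  ext v k w
  rfl

/-- Norm bound for the shift: `‖shift j‖ ≤ ‖j‖`. [folklore] -/
theorem Jet.norm_shiftFun_le {m : ℕ} (j : Jet X W (m + 1)) : ‖Jet.shiftFun j‖ ≤ ‖j‖ := by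
  refine ContinuousLinearMap.opNorm_le_bound _ (norm_nonneg _) fun v => ?_
  rw [pi_norm_le_iff_of_nonneg (by positivity)]
  intro k
  calc ‖Jet.shiftFun j v k‖
      = ‖continuousMultilinearCurryLeftEquiv ℝ (fun _ : Fin ((k : ℕ) + 1) => X) W (j k.succ) v‖ :=
        rfl
    _ ≤ ‖continuousMultilinearCurryLeftEquiv ℝ (fun _ : Fin ((k : ℕ) + 1) => X) W (j k.succ)‖ *
          ‖v‖ := ContinuousLinearMap.le_opNorm _ _
    _ = ‖j k.succ‖ * ‖v‖ := by rw [LinearIsometryEquiv.norm_map]; rfl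
    _ ≤ ‖j‖ * ‖v‖ := mul_le_mul_of_nonneg_right (norm_le_pi_norm j _) (norm_nonneg _)

/-- **The shift is a bounded linear map** `Jet (m+1) → (X →L Jet m)` (hence smooth); it is
kept unbundled, as the function `Jet.shiftFun`, to avoid committing to an instance path on the
`Π`-type `Jet`. [folklore] -/
theorem Jet.isBoundedLinearMap_shiftFun (m : ℕ) :
    IsBoundedLinearMap ℝ (fun j : Jet X W (m + 1) => Jet.shiftFun j) where
  map_add := Jet.shiftFun_add
  map_smul := Jet.shiftFun_smul
  bound := ⟨1, one_pos, fun j => by rw [one_mul]; exact Jet.norm_shiftFun_le j⟩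

/-- The shift is smooth in the jet. [folklore] -/
theorem Jet.contDiff_shiftFun (m : ℕ) {n : WithTop ℕ∞} :
    ContDiff ℝ n (fun j : Jet X W (m + 1) => Jet.shiftFun j) :=
  (Jet.isBoundedLinearMap_shiftFun m).contDiff

/-- **The derivative of the jet map is the shift of the next jet**: for smooth `f`,
`D(jet m f)(x) = shift (jet (m+1) f x)` (componentwise this is Mathlib's `fderiv_iteratedFDeriv`:
`D(D^k f)(x) v = D^{k+1}f(x)(v, ·)`). [folklore] -/
theorem hasFDerivAt_jet {f : X → W} (hf : ContDiff ℝ ∞ f) (m : ℕ) (x : X) :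
    HasFDerivAt (jet m f) (Jet.shiftFun (jet (m + 1) f x)) x := by
  rw [hasFDerivAt_pi']
  intro k
  have hk : ((k : ℕ) : WithTop ℕ∞) < ∞ := by exact_mod_cast ENat.coe_lt_top (k : ℕ)
  have hd : DifferentiableAt ℝ (iteratedFDeriv ℝ (k : ℕ) f) x :=
    (hf.differentiable_iteratedFDeriv hk) x
  have h := hd.hasFDerivAt
  rw [fderiv_iteratedFDeriv] at h
  refine h.congr_fderiv ?_
  ext v w
  rfl

/-! ### Smooth jet expressions -/

/-- **Smooth jet expressions of order `m`** of a time-dependent family `b : ℝ → X → W`: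
`F : ℝ × X → V` is of the form `F(t, x) = Φ(t, x, jet m (b t) x)` for some `C^∞` map `Φ` on
`ℝ × X × Jet m` (the class `𝒲_m` of the module docstring). [folklore] -/
def IsJetExprOf (b : ℝ → X → W) (m : ℕ) {V : Type u} [NormedAddCommGroup V] [NormedSpace ℝ V]
    (F : ℝ × X → V) : Prop :=
  ∃ Φ : ℝ × X × Jet X W m → V, ContDiff ℝ ∞ Φ ∧ ∀ t x, F (t, x) = Φ (t, x, jet m (b t) x)

variable {b : ℝ → X → W}
variable {V : Type u} [NormedAddCommGroup V] [NormedSpace ℝ V]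

/-- Raising the order of a jet expression (compose with the truncation). [folklore] -/
theorem IsJetExprOf.mono {m m' : ℕ} {F : ℝ × X → V} (hF : IsJetExprOf b m F) (h : m ≤ m') :
    IsJetExprOf b m' F := by
  obtain ⟨Φ, hΦ, hFΦ⟩ := hF
  refine ⟨fun q => Φ (q.1, q.2.1, Jet.truncLE h q.2.2), ?_, fun t x => ?_⟩
  · exact hΦ.comp (contDiff_fst.prodMk ((contDiff_fst.comp contDiff_snd).prodMk
      ((Jet.truncLE (X := X) (W := W) h).contDiff.comp (contDiff_snd.comp contDiff_snd))))
  · rw [hFΦ]; rfl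

/-- `b` itself is a jet expression of order `0` (`Φ(t, x, j) = j₀`). [folklore] -/
theorem isJetExprOf_self (b : ℝ → X → W) : IsJetExprOf b 0 (fun p : ℝ × X => b p.1 p.2) := by
  refine ⟨fun q => continuousMultilinearCurryFin0 ℝ X W (q.2.2 0), ?_, fun t x => ?_⟩
  · exact (continuousMultilinearCurryFin0 ℝ X W).toContinuousLinearEquiv.contDiff.comp
      ((ContinuousLinearMap.proj (R := ℝ)
        (φ := fun k : Fin 1 => ContinuousMultilinearMap ℝ (fun _ : Fin k => X) W) 0).contDiff.comp
        (contDiff_snd.comp contDiff_snd))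
  · simp [jet]

/-- The map `(t, x) ↦ jet m (b t) x` is continuous when all spatial derivatives of `b` are jointly
continuous. [folklore] -/
theorem continuous_jet_uncurry
    (hb2 : ∀ k : ℕ, Continuous fun p : ℝ × X => iteratedFDeriv ℝ k (b p.1) p.2) (m : ℕ) :
    Continuous fun p : ℝ × X => jet m (b p.1) p.2 :=
  continuous_pi fun k => hb2 k

/-- **(i) Jet expressions are continuous** (joint continuity of the spatial derivatives of `b`).
[folklore] -/
theorem IsJetExprOf.continuous {m : ℕ} {F : ℝ × X → V} (hF : IsJetExprOf b m F)
    (hb2 : ∀ k : ℕ, Continuous fun p : ℝ × X => iteratedFDeriv ℝ k (b p.1) p.2) :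
    Continuous F := by
  obtain ⟨Φ, hΦ, hFΦ⟩ := hF
  have h : F = fun p : ℝ × X => Φ (p.1, p.2, jet m (b p.1) p.2) := by
    funext p; exact hFΦ p.1 p.2
  rw [h]
  exact hΦ.continuous.comp (continuous_fst.prodMk (continuous_snd.prodMk
    (continuous_jet_uncurry hb2 m)))

/-- The linear map `v ↦ (0, v, shift j v) : X → ℝ × X × Jet m` (the derivative of
`y ↦ (t, y, jet m f y)` at a point where `jet (m+1) f = j`). [folklore] -/
def Jet.sliceDeriv (m : ℕ) (j : Jet X W (m + 1)) : X →L[ℝ] ℝ × X × Jet X W m :=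
  (0 : X →L[ℝ] ℝ).prod ((ContinuousLinearMap.id ℝ X).prod (Jet.shiftFun j))

/-- Values of `sliceDeriv`. [folklore] -/
@[simp]
theorem Jet.sliceDeriv_apply (m : ℕ) (j : Jet X W (m + 1)) (v : X) :
    Jet.sliceDeriv m j v = ((0 : ℝ), v, Jet.shiftFun j v) := rfl

/-- The affine structure of `sliceDeriv`: a constant plus `inr ∘ inr ∘ shift j`. [folklore] -/
theorem Jet.sliceDeriv_eq (m : ℕ) (j : Jet X W (m + 1)) :
    Jet.sliceDeriv m j =
      (0 : X →L[ℝ] ℝ).prod ((ContinuousLinearMap.id ℝ X).prod (0 : X →L[ℝ] Jet X W m)) +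
        (ContinuousLinearMap.inr ℝ ℝ (X × Jet X W m)).comp
          ((ContinuousLinearMap.inr ℝ X (Jet X W m)).comp (Jet.shiftFun j)) := by
  refine ContinuousLinearMap.ext fun v => ?_
  simp [Jet.sliceDeriv_apply]

/-- `j ↦ sliceDeriv j` is smooth (affine-linear in `j`). [folklore] -/
theorem Jet.contDiff_sliceDeriv (m : ℕ) :
    ContDiff ℝ ∞ (fun j : Jet X W (m + 1) => Jet.sliceDeriv m j) := by
  have h : (fun j : Jet X W (m + 1) => Jet.sliceDeriv m j) = fun j =>
      (0 : X →L[ℝ] ℝ).prod ((ContinuousLinearMap.id ℝ X).prod (0 : X →L[ℝ] Jet X W m)) +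
        (ContinuousLinearMap.inr ℝ ℝ (X × Jet X W m)).comp
          ((ContinuousLinearMap.inr ℝ X (Jet X W m)).comp (Jet.shiftFun j)) := by
    funext j; exact Jet.sliceDeriv_eq m j
  rw [h]
  exact contDiff_const.add (contDiff_const.clm_comp (contDiff_const.clm_comp
    (Jet.contDiff_shiftFun m)))

/-- **(ii) Jet expressions are differentiable in `x`, the derivative being a jet expression of
one order more**: if `F(t, x) = Φ(t, x, jet m (b t) x)` then
`D_x F(t, x) = DΦ(t, x, jet m (b t) x) ∘ (0, id, shift (jet (m+1) (b t) x))`. [folklore] -/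
theorem IsJetExprOf.hasFDerivAt_snd {m : ℕ} {F : ℝ × X → V} (hF : IsJetExprOf b m F)
    (hb1 : ∀ t, ContDiff ℝ ∞ (b t)) :
    ∃ F₂ : ℝ × X → (X →L[ℝ] V), IsJetExprOf b (m + 1) F₂ ∧
      ∀ p : ℝ × X, HasFDerivAt (fun y => F (p.1, y)) (F₂ p) p.2 := by
  obtain ⟨Φ, hΦ, hFΦ⟩ := hF
  obtain ⟨hΦdiff, hΦ'⟩ := contDiff_infty_iff_fderiv.1 hΦ
  -- the derivative expression, of order `m + 1`
  let Φ₂ : ℝ × X × Jet X W (m + 1) → (X →L[ℝ] V) := fun q =>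
    (fderiv ℝ Φ (q.1, q.2.1, Jet.truncLE (Nat.le_succ m) q.2.2)).comp (Jet.sliceDeriv m q.2.2)
  have hΦ₂ : ContDiff ℝ ∞ Φ₂ := by
    have h1 : ContDiff ℝ ∞ fun q : ℝ × X × Jet X W (m + 1) =>
        fderiv ℝ Φ (q.1, q.2.1, Jet.truncLE (Nat.le_succ m) q.2.2) :=
      hΦ'.comp (contDiff_fst.prodMk ((contDiff_fst.comp contDiff_snd).prodMk
        ((Jet.truncLE (X := X) (W := W) (Nat.le_succ m)).contDiff.comp (contDiff_snd.comp contDiff_snd))))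
    have h2 : ContDiff ℝ ∞ fun q : ℝ × X × Jet X W (m + 1) => Jet.sliceDeriv m q.2.2 :=
      (Jet.contDiff_sliceDeriv m).comp (contDiff_snd.comp contDiff_snd)
    exact h1.clm_comp h2
  refine ⟨fun p => Φ₂ (p.1, p.2, jet (m + 1) (b p.1) p.2), ⟨Φ₂, hΦ₂, fun t x => rfl⟩, fun p => ?_⟩
  -- the chain rule along `y ↦ (t, y, jet m (b t) y)`
  have hγ : HasFDerivAt (fun y : X => ((p.1, y, jet m (b p.1) y) : ℝ × X × Jet X W m))
      (Jet.sliceDeriv m (jet (m + 1) (b p.1) p.2)) p.2 :=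
    (hasFDerivAt_const p.1 p.2).prodMk ((hasFDerivAt_id p.2).prodMk
      (hasFDerivAt_jet (hb1 p.1) m p.2))
  have hΦd : HasFDerivAt Φ (fderiv ℝ Φ (p.1, p.2, jet m (b p.1) p.2))
      (p.1, p.2, jet m (b p.1) p.2) := (hΦdiff _).hasFDerivAt
  have hcomp := hΦd.comp p.2 hγ
  have hfun : (fun y => F (p.1, y)) =
      Φ ∘ fun y : X => ((p.1, y, jet m (b p.1) y) : ℝ × X × Jet X W m) := by
    funext y; exact hFΦ p.1 y
  rw [hfun]
  exact hcomp

/-! ### Prolongation of the right-hand side -/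

variable {m₀ : ℕ}

/-- The **right-hand side evaluated on the jet of a slice**: `rhsSlice N b t = N(t, ·, jet m₀ (b t))`,
the spatial function whose jets are the time derivatives of the jets of `b`. [folklore] -/
def rhsSlice (N : ℝ × X × Jet X W m₀ → W) (b : ℝ → X → W) (t : ℝ) : X → W :=
  fun y => N (t, y, jet m₀ (b t) y)

/-- Unfolding `rhsSlice`. [folklore] -/
theorem rhsSlice_apply (N : ℝ × X × Jet X W m₀ → W) (b : ℝ → X → W) (t : ℝ) (y : X) :
    rhsSlice N b t y = N (t, y, jet m₀ (b t) y) := rfl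

variable {N : ℝ × X × Jet X W m₀ → W}

/-- **Prolongation, one component**: for every `k`, the `k`-th spatial derivative of
`N(t, ·, jet m₀ (b t))` is a smooth jet expression of `b` of order `m₀ + k` (induction on `k`:
the step is (ii) followed by the inverse currying isometry `D^{k+1} = curry⁻¹ ∘ D(D^k)`).
[folklore] -/
theorem isJetExprOf_iteratedFDeriv_rhsSlice (hb1 : ∀ t, ContDiff ℝ ∞ (b t))
    (hN : ContDiff ℝ ∞ N) (k : ℕ) :
    IsJetExprOf b (m₀ + k)
      (fun p : ℝ × X => iteratedFDeriv ℝ k (rhsSlice N b p.1) p.2) := by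
  induction k with
  | zero =>
    refine ⟨fun q => (continuousMultilinearCurryFin0 ℝ X W).symm (N q), ?_, fun t x => ?_⟩
    · exact (continuousMultilinearCurryFin0 ℝ X W).symm.toContinuousLinearEquiv.contDiff.comp hN
    · rfl
  | succ k ih =>
    obtain ⟨F₂, ⟨Φ', hΦ', hF₂⟩, hD⟩ := ih.hasFDerivAt_snd hb1
    refine ⟨fun q => (continuousMultilinearCurryLeftEquiv ℝ (fun _ : Fin (k + 1) => X) W).symm
        (Φ' q), ?_, fun t x => ?_⟩
    · exact (continuousMultilinearCurryLeftEquiv ℝ (fun _ : Fin (k + 1) => X) W).symm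
        |>.toContinuousLinearEquiv.contDiff.comp hΦ'
    · -- `D^{k+1} g (x) = curry⁻¹ (D (D^k g) (x))` and `D(D^k g)(x) = F₂ (t, x) = Φ' (…)`
      have hfd : fderiv ℝ (iteratedFDeriv ℝ k (rhsSlice N b t)) x = F₂ (t, x) := (hD (t, x)).fderiv
      show iteratedFDeriv ℝ (k + 1) (rhsSlice N b t) x = _
      rw [iteratedFDeriv_succ_eq_comp_left, Function.comp_apply, hfd, hF₂ t x]
      rfl

/-- **Prolongation**: the `m`-jet of `N(t, ·, jet m₀ (b t))` is a smooth jet expression of `b` of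
order `m₀ + m`. [folklore] -/
theorem isJetExprOf_jet_rhsSlice (hb1 : ∀ t, ContDiff ℝ ∞ (b t)) (hN : ContDiff ℝ ∞ N) (m : ℕ) :
    IsJetExprOf b (m₀ + m) (fun p : ℝ × X => jet m (rhsSlice N b p.1) p.2) := by
  have h := fun k : Fin (m + 1) => isJetExprOf_iteratedFDeriv_rhsSlice hb1 hN (k : ℕ)
  choose Ψ hΨ hΨeq using h
  have hk : ∀ k : Fin (m + 1), m₀ + (k : ℕ) ≤ m₀ + m := fun k => by
    have := k.is_lt; omega
  refine ⟨fun q => fun k => Ψ k (q.1, q.2.1, Jet.truncLE (hk k) q.2.2), ?_, fun t x => ?_⟩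
  · exact contDiff_pi.2 fun k => (hΨ k).comp (contDiff_fst.prodMk
      ((contDiff_fst.comp contDiff_snd).prodMk
        ((Jet.truncLE (X := X) (W := W) (hk k)).contDiff.comp (contDiff_snd.comp contDiff_snd))))
  · funext k
    exact hΨeq k t x

/-- **(iii) Jet expressions are differentiable in `t`, the derivative being a jet expression**
(of order `m₀ + m`), provided the jets of `b` evolve by the equation:
`∂ₜ D_x^k b(·, x) = D_x^k (N(t, ·, jet m₀ (b t)))(x)` for all `k`. The derivative of
`Φ(t, x, jet m (b t) x)` is `DΦ(…)(1, 0, jet m (N(t, ·, jet b)) x)`, and the last jet is a jet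
expression by prolongation. [folklore] -/
theorem IsJetExprOf.hasDerivAt_fst {m : ℕ} {F : ℝ × X → V} (hF : IsJetExprOf b m F)
    (hN : ContDiff ℝ ∞ N) (hb1 : ∀ t, ContDiff ℝ ∞ (b t))
    (hb3 : ∀ (k : ℕ) (t : ℝ) (x : X), HasDerivAt (fun τ => iteratedFDeriv ℝ k (b τ) x)
      (iteratedFDeriv ℝ k (rhsSlice N b t) x) t) :
    ∃ F₁ : ℝ × X → V, IsJetExprOf b (m₀ + m) F₁ ∧
      ∀ p : ℝ × X, HasDerivAt (fun τ => F (τ, p.2)) (F₁ p) p.1 := by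
  obtain ⟨Φ, hΦ, hFΦ⟩ := hF
  obtain ⟨hΦdiff, hΦ'⟩ := contDiff_infty_iff_fderiv.1 hΦ
  obtain ⟨Ψ, hΨ, hΨeq⟩ := isJetExprOf_jet_rhsSlice hb1 hN m (b := b)
  have hm : m ≤ m₀ + m := Nat.le_add_left m m₀
  let Φ₁ : ℝ × X × Jet X W (m₀ + m) → V := fun q =>
    fderiv ℝ Φ (q.1, q.2.1, Jet.truncLE hm q.2.2) ((1 : ℝ), (0 : X), Ψ q)
  have hΦ₁ : ContDiff ℝ ∞ Φ₁ := by
    have h1 : ContDiff ℝ ∞ fun q : ℝ × X × Jet X W (m₀ + m) =>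
        fderiv ℝ Φ (q.1, q.2.1, Jet.truncLE hm q.2.2) :=
      hΦ'.comp (contDiff_fst.prodMk ((contDiff_fst.comp contDiff_snd).prodMk
        ((Jet.truncLE (X := X) (W := W) hm).contDiff.comp (contDiff_snd.comp contDiff_snd))))
    have h2 : ContDiff ℝ ∞ fun q : ℝ × X × Jet X W (m₀ + m) =>
        (((1 : ℝ), (0 : X), Ψ q) : ℝ × X × Jet X W m) :=
      contDiff_const.prodMk (contDiff_const.prodMk hΨ)
    exact h1.clm_apply h2
  refine ⟨fun p => Φ₁ (p.1, p.2, jet (m₀ + m) (b p.1) p.2), ⟨Φ₁, hΦ₁, fun t x => rfl⟩, fun p => ?_⟩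
  -- the curve `τ ↦ (τ, x, jet m (b τ) x)` and its velocity `(1, 0, jet m (N-slice) x)`
  have hc : HasDerivAt (fun τ : ℝ => ((τ, p.2, jet m (b τ) p.2) : ℝ × X × Jet X W m))
      ((1 : ℝ), (0 : X), jet m (rhsSlice N b p.1) p.2) p.1 := by
    refine (hasDerivAt_id p.1).prodMk ((hasDerivAt_const p.1 p.2).prodMk ?_)
    exact hasDerivAt_pi.2 fun k => hb3 k p.1 p.2
  have hΦd : HasFDerivAt Φ (fderiv ℝ Φ (p.1, p.2, jet m (b p.1) p.2))
      (p.1, p.2, jet m (b p.1) p.2) := (hΦdiff _).hasFDerivAt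
  have hcomp := hΦd.comp_hasDerivAt p.1 hc
  have hfun : (fun τ => F (τ, p.2)) =
      Φ ∘ fun τ : ℝ => ((τ, p.2, jet m (b τ) p.2) : ℝ × X × Jet X W m) := by
    funext τ; exact hFΦ τ p.2
  rw [hfun]
  refine hcomp.congr_deriv ?_
  -- identify the velocity with `Φ₁` at the top jet
  have hj : jet m (rhsSlice N b p.1) p.2 = Ψ (p.1, p.2, jet (m₀ + m) (b p.1) p.2) := hΨeq p.1 p.2
  simp only [Φ₁, Jet.truncLE_jet, hj]

/-! ### The bootstrap -/

/-- **(iv) Every smooth jet expression is `C^n`, for every `n`** (induction on `n`, simultaneously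
for all orders and all target spaces: the partial derivatives of a jet expression are jet
expressions, by (ii) and (iii), and `C^n` partial derivatives give `C^{n+1}`,
`contDiffOn_succ_of_partial`). [folklore] -/
theorem contDiff_of_isJetExprOf (hN : ContDiff ℝ ∞ N) (hb1 : ∀ t, ContDiff ℝ ∞ (b t))
    (hb2 : ∀ k : ℕ, Continuous fun p : ℝ × X => iteratedFDeriv ℝ k (b p.1) p.2)
    (hb3 : ∀ (k : ℕ) (t : ℝ) (x : X), HasDerivAt (fun τ => iteratedFDeriv ℝ k (b τ) x)
      (iteratedFDeriv ℝ k (rhsSlice N b t) x) t) (n : ℕ) :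
    ∀ {V : Type u} [NormedAddCommGroup V] [NormedSpace ℝ V] {m : ℕ} {F : ℝ × X → V},
      IsJetExprOf b m F → ContDiff ℝ n F := by
  induction n with
  | zero =>
    intro V _ _ m F hF
    exact contDiff_zero.2 (hF.continuous hb2)
  | succ n ih =>
    intro V _ _ m F hF
    obtain ⟨F₁, hF₁, h₁⟩ := hF.hasDerivAt_fst hN hb1 hb3
    obtain ⟨F₂, hF₂, h₂⟩ := hF.hasFDerivAt_snd hb1
    have hc₁ : ContDiff ℝ n F₁ := ih hF₁
    have hc₂ : ContDiff ℝ n F₂ := ih hF₂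
    have hc₁' : ContDiff ℝ n fun p : ℝ × X => (1 : ℝ →L[ℝ] ℝ).smulRight (F₁ p) :=
      contDiff_const.smulRight hc₁
    have h := contDiffOn_succ_of_partial isOpen_univ (f := F) (U := univ)
      (fun p _ => (h₁ p).hasFDerivAt) (fun p _ => h₂ p) hc₁'.contDiffOn hc₂.contDiffOn
    rw [contDiffOn_univ] at h
    exact_mod_cast h

/-- **Joint smoothness from slice-wise smoothness and the equation.** Let `b : ℝ → X → W` and a
smooth `N : ℝ × X × Jet m₀ → W` be such that (1) every slice `b t` is `C^∞`; (2) every spatial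
derivative `(t, x) ↦ D_x^k (b t)(x)` is jointly continuous; (3) for all `k, t, x`,
`τ ↦ D_x^k (b τ)(x)` is differentiable at `t` with derivative `D_x^k (N(t, ·, jet m₀ (b t)))(x)`
(the equation `∂ₜ b = N(t, x, jet b)` differentiated `k` times in `x`). Then
`(t, x) ↦ b t x` is `C^∞` on `ℝ × X` ("using the system on `u`, we get a control of the `C^s`
norm in all variables", Alinhac 2009, proof of Thm. 7.11, Step 2 (d)).
[cite: AlinhacHPDE2009, Thm. 7.11 proof Step 2 (d)] -/
theorem contDiff_uncurry_of_jet_evolution {b : ℝ → X → W} {m₀ : ℕ}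
    {N : ℝ × X × Jet X W m₀ → W} (hN : ContDiff ℝ ∞ N) (hb1 : ∀ t, ContDiff ℝ ∞ (b t))
    (hb2 : ∀ k : ℕ, Continuous fun p : ℝ × X => iteratedFDeriv ℝ k (b p.1) p.2)
    (hb3 : ∀ (k : ℕ) (t : ℝ) (x : X), HasDerivAt (fun τ => iteratedFDeriv ℝ k (b τ) x)
      (iteratedFDeriv ℝ k (rhsSlice N b t) x) t) :
    ContDiff ℝ ∞ (Function.uncurry b) :=
  contDiff_infty.2 fun n => contDiff_of_isJetExprOf hN hb1 hb2 hb3 n (isJetExprOf_self b)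

end Literature.Analysis.Calculus

end
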